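import Mathlib.AlgebraicGeometry.Morphisms.Proper
import Literature.AlgebraicGeometry.Morphisms.OpenGluing
import Literature.AlgebraicGeometry.Morphisms.OpenGluingProofs

/-!
# Stub `stub_openGluing` of the line `sandwiched-gluing` (crux `Theses.Valuative.PatchingRel`)

The registered stub `stub_openGluing : OpenGluing.{0}` — two-piece relative gluing of schemes
(The Stacks Project, Tag 01LH) — is the universe-`0` instance of the Literature discharge
`Literature.AlgebraicGeometry.Morphisms.OpenGluing_holds`
(`Literature/AlgebraicGeometry/Morphisms/OpenGluingProofs.lean`, built on Mathlib's pushout of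
schemes along open immersions).
-/

set_option linter.dupNamespace false  -- Summit.<S>.<S>.Theorems is the D-0017 layout (single-conjunct summit)

noncomputable section

open CategoryTheory AlgebraicGeometry
open Literature.AlgebraicGeometry.Morphisms

namespace Summit.ResolutionOfSingularities.ResolutionOfSingularities.Theorems

/-- **Relative gluing, two pieces** (registered stub of the line `sandwiched-gluing`): for opens
`V, W` covering a scheme `S` and `π : Y → V` an isomorphism over `V ∩ W`, there are
`ρ : N → S` and an open immersion `i : Y → N`, cartesian over `V ↪ S`, with `ρ ∣_ W` an
isomorphism and `ρ` proper when `π` is. Discharged by `OpenGluing_holds`.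
[cite: StacksProject, Tag 01LH] -/
theorem stub_openGluing : OpenGluing.{0} := OpenGluing_holds

end Summit.ResolutionOfSingularities.ResolutionOfSingularities.Theorems

end
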